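import Literature.Barriers.PneNP.TSPExtensionComplexityMatchingsOps
import Literature.Combinatorics.SimpleGraph.CycleSpaceSeparators
import Mathlib.Algebra.BigOperators.Field
import Mathlib.Algebra.BigOperators.Ring.Finset
import Mathlib.Algebra.Order.BigOperators.Group.Finset
import Mathlib.Data.Fintype.BigOperators
import Mathlib.Data.Finset.Sym
import Mathlib.Data.Real.Basic
import Mathlib.Data.Fintype.Fin
import Mathlib.Data.Fintype.Sigma
import Mathlib.Tactic.Ring
import Mathlib.Tactic.Linarith
import Mathlib.Tactic.FieldSimp
import HarnessLib

/-!
# Rothvoß's partitions and the laws of his two sampling procedures (§3.1–3.2)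

Support file for the discharge of `Literature.Barriers.PneNP.Rothvoss2017_tsp` along the route
of `…RothvossAssembly.lean` (`rothvoss2017_tsp_of_weights`): the weights fed to the hyperplane
separation bound are the LAWS of the pairs `(U, M)` produced by Rothvoß's two generating
procedures (§3.2, PDF p. 9: "Pick a random partition `T`. Pick a random `3`-matching
`H ⊆ C × D` [resp. `k`-matching `F`]. Then randomly extend"), so that the rectangle bound of
Lemma 6 becomes literally the inequality between the two expectations
`E_T E_H[p^ex_M p^ex_U]` and `E_T E_F[p^ex_M p^ex_U]` that §§3.3–3.6 establish (and the
identification of these laws with the uniform measures on `Q_3`, `Q_k` — §3.2 — is not needed).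
This file sets up (§3.1, PDF p. 8):

* `Lbl m` — the block labels `A i, C, D, B i`; a **partition** is a labelling
  `lab : Fin n → Lbl m` with class sizes `k-3, k, k, 2(k-3)` (`partitions n m k`); `lblk lab ℓ`;
* `EResp lab e` — the edge `e` lies in `E(T) = ⋃ E(A_i) ∪ E(C ∪ D) ∪ ⋃ E(B_i)`;
  `Mall lab` — the perfect matchings respecting `T`; `Uall lab t` — the `t`-cuts inside `A ∪ C`
  made of whole `A`-blocks; `IsCD`, `cdMatchings lab r` — the `r`-matchings between `C` and `D`;
  `cov lab H` — `V(H) ∩ C`; the extension sets `Mext lab H = {M ∈ M_all(T) : M ∩ (C × D) = H}`,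
  `Uext lab t H = {U ∈ U_all(T) : U ∩ C = V(H) ∩ C}`;
* `Omega n m k t r` — the sample space `Ω_r` of compatible triples `(T, U, M)` (with
  `H := M ∩ (C × D)` an `r`-matching, `U ∈ Uext`, `M ∈ Mext`); `law n m k t r U M` — the
  probability of the pair `(U, M)` under the UNIFORM distribution on `Ω_r` (a convenient
  reweighting of "uniform `T`, uniform `H`, uniform extensions" needing no cardinality
  computations); `OmegaR` — the outcomes inside a rectangle;
* the structural facts the assembly consumes: `law_nonneg`, `filter_crosses_eq_of_mem_ext`
  (for `U ∈ Uext lab t H`, `M ∈ Mext lab H` the crossing edges `δ(U) ∩ M` are exactly `H`, so the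
  law with `r`-matchings is supported on `|δ(U) ∩ M| = r`), `sum_sum_law_eq` (the law of a
  rectangle is `|Ω_r ∩ (X × Y)| / |Ω_r|`), the non-emptiness of all sampling sets
  (`partitions_nonempty`, `cdMatchings_nonempty`, `uext_nonempty`, `mext_nonempty`,
  `omega_nonempty`) and the total mass `sum_sum_law_univ = 1`; finally the conditional
  probabilities `pU`, `pM` (Rothvoß's `p^ex_{U,T}`, `p^ex_{M,T}`) used by §§3.3–3.6.

Sources: [Rothvoss2017] §3.1 (PDF p. 8: partitions, `E(T)`, `𝓜(T)`, `𝓤(T)`), §3.2 (PDF p. 9: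
the two generating procedures, `p^ex_{M,T}`, `p^ex_{U,T}`).
-/

noncomputable section

namespace Literature.Barriers.PneNP

open Finset Literature.Combinatorics.SimpleGraph.CycleSpace

/-! ### Labels and partitions -/

/-- The block labels of a partition `T = (A_1, …, A_m, C, D, B_1, …, B_m)`.
[cite: Rothvoss2017, §3.1 (PDF p. 8)] -/
inductive Lbl (m : ℕ) : Type
  /-- the blocks `A_i`, `|A_i| = k - 3` -/
  | A (i : Fin m)
  /-- the core `C`, `|C| = k` -/
  | C
  /-- the block `D`, `|D| = k` -/
  | D
  /-- the blocks `B_i`, `|B_i| = 2(k-3)` -/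
  | B (i : Fin m)
  deriving DecidableEq

namespace Lbl

variable {m : ℕ}

/-- `Lbl m` as a sum type. [folklore] -/
def equivSum : Lbl m ≃ Fin m ⊕ Unit ⊕ Unit ⊕ Fin m where
  toFun
    | A i => Sum.inl i
    | C => Sum.inr (Sum.inl ())
    | D => Sum.inr (Sum.inr (Sum.inl ()))
    | B i => Sum.inr (Sum.inr (Sum.inr i))
  invFun
    | Sum.inl i => A i
    | Sum.inr (Sum.inl _) => C
    | Sum.inr (Sum.inr (Sum.inl _)) => D
    | Sum.inr (Sum.inr (Sum.inr i)) => B i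
  left_inv x := by cases x <;> rfl
  right_inv y := by rcases y with i | ⟨⟨⟩⟩ | ⟨⟨⟩⟩ | i <;> rfl

/-- `Lbl m` is finite. [folklore] -/
instance : Fintype (Lbl m) := Fintype.ofEquiv _ equivSum.symm

/-- The prescribed block sizes `|A_i| = k-3`, `|C| = |D| = k`, `|B_i| = 2(k-3)`.
[cite: Rothvoss2017, §3.1 (PDF p. 8)] -/
def size (k : ℕ) : Lbl m → ℕ
  | A _ => k - 3
  | C => k
  | D => k
  | B _ => 2 * (k - 3)

/-- The edge class of a label: `C` and `D` merged (edges inside `C ∪ D` respect `T`).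
[cite: Rothvoss2017, §3.1 (PDF p. 8: "E(T) := ⋃ E(A_i) ∪ E(C ∪ D) ∪ ⋃ E(B_i)")] -/
def cls : Lbl m → Lbl m
  | D => C
  | x => x

/-- Labels of the side `A ∪ C` carrying the cuts. [folklore] -/
def isAC : Lbl m → Bool
  | A _ => true
  | C => true
  | _ => false

/-- Labels of the `A`-blocks. [folklore] -/
def isA : Lbl m → Bool
  | A _ => true
  | _ => false

/-- `cls (A i) = A i`. [folklore] -/
@[simp] theorem cls_A (i : Fin m) : cls (A i : Lbl m) = A i := rfl
/-- `cls (B i) = B i`. [folklore] -/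
@[simp] theorem cls_B (i : Fin m) : cls (B i : Lbl m) = B i := rfl
/-- `cls C = C`. [folklore] -/
@[simp] theorem cls_C : cls (C : Lbl m) = C := rfl
/-- `cls D = C` (`C` and `D` merged). [folklore] -/
@[simp] theorem cls_D : cls (D : Lbl m) = C := rfl

/-- `cls ℓ = C` iff `ℓ ∈ {C, D}`. [folklore] -/
theorem cls_eq_C_iff {ℓ : Lbl m} : cls ℓ = C ↔ ℓ = C ∨ ℓ = D := by
  cases ℓ <;> simp [cls]

/-- `cls ℓ = A i` iff `ℓ = A i`. [folklore] -/
theorem cls_eq_A_iff {ℓ : Lbl m} {i : Fin m} : cls ℓ = A i ↔ ℓ = A i := by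
  cases ℓ <;> simp [cls]

end Lbl

open Lbl

variable {n m k : ℕ}

/-- **Partitions** `T = (A_1,…,A_m, C, D, B_1,…,B_m)` of `[n]` as labellings with the prescribed
class sizes. [cite: Rothvoss2017, §3.1 (PDF p. 8)] -/
def partitions (n m k : ℕ) : Finset (Fin n → Lbl m) :=
  univ.filter fun lab => ∀ ℓ : Lbl m, (univ.filter fun v => lab v = ℓ).card = ℓ.size k

/-- The block of label `ℓ`. [folklore] -/
def lblk (lab : Fin n → Lbl m) (ℓ : Lbl m) : Finset (Fin n) := univ.filter fun v => lab v = ℓ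

/-- Membership in a block. [folklore] -/
@[simp] theorem mem_lblk {lab : Fin n → Lbl m} {ℓ : Lbl m} {v : Fin n} : v ∈ lblk lab ℓ ↔ lab v = ℓ := by
  simp [lblk]

/-- Membership in `partitions`. [folklore] -/
theorem mem_partitions_iff {lab : Fin n → Lbl m} :
    lab ∈ partitions n m k ↔ ∀ ℓ : Lbl m, (lblk lab ℓ).card = ℓ.size k := by
  simp [partitions, lblk]

/-! ### Edges respecting a partition; `M_all(T)`, `U_all(T)` -/

/-- The edge `e` lies in `E(T)`: both ends in the same `A_i`, or the same `B_i`, or in `C ∪ D`.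
[cite: Rothvoss2017, §3.1 (PDF p. 8)] -/
def EResp (lab : Fin n → Lbl m) (e : Sym2 (Fin n)) : Prop := (e.map (cls ∘ lab)).IsDiag

/-- `{u, v}` respects `T` iff `cls (lab u) = cls (lab v)`. [folklore] -/
@[simp] theorem eResp_mk {lab : Fin n → Lbl m} {u v : Fin n} :
    EResp lab s(u, v) ↔ cls (lab u) = cls (lab v) := by
  simp [EResp]

/-- Respecting a partition is decidable. [folklore] -/
instance (lab : Fin n → Lbl m) : DecidablePred (EResp lab) := fun e => by
  unfold EResp; infer_instance

/-- `M_all(T)`: the perfect matchings of `[n]` using only edges of `E(T)`.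
[cite: Rothvoss2017, §3.1 (PDF p. 8: "𝓜_all(T) := {M ∈ 𝓜_all | M ⊆ E(T)}")] -/
def Mall (lab : Fin n → Lbl m) : Finset (Finset (Sym2 (Fin n))) :=
  (perfectMatchings (univ : Finset (Fin n))).filter fun M => ∀ e ∈ M, EResp lab e

/-- Membership in `Mall`. [folklore] -/
theorem mem_Mall_iff {lab : Fin n → Lbl m} {M : Finset (Sym2 (Fin n))} :
    M ∈ Mall lab ↔ IsPMOn (univ : Finset (Fin n)) M ∧ ∀ e ∈ M, EResp lab e := by
  simp [Mall, mem_perfectMatchings]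

/-- `U_all(T)`: the `t`-cuts inside `A ∪ C` made of whole `A`-blocks.
[cite: Rothvoss2017, §3.1 (PDF p. 8: "𝓤_all(T) := {U : U ⊆ A ∪ C; |U ∩ A_i| ∈ {0, |A_i|} ∀ i}")] -/
def Uall (lab : Fin n → Lbl m) (t : ℕ) : Finset (Finset (Fin n)) :=
  (univ.powersetCard t).filter fun U =>
    (∀ v ∈ U, (lab v).isAC = true) ∧ ∀ u ∈ U, ∀ v, lab v = lab u → (lab u).isA = true → v ∈ U

/-- Membership in `Uall`. [folklore] -/
theorem mem_Uall_iff {lab : Fin n → Lbl m} {t : ℕ} {U : Finset (Fin n)} :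
    U ∈ Uall lab t ↔ U.card = t ∧ (∀ v ∈ U, (lab v).isAC = true) ∧
      ∀ u ∈ U, ∀ v, lab v = lab u → (lab u).isA = true → v ∈ U := by
  simp [Uall, mem_powersetCard]

/-! ### Matchings between `C` and `D` -/

/-- `e` is an edge between `C` and `D`. [cite: Rothvoss2017, §3.2 (PDF p. 9: "H ⊆ C × D")] -/
def IsCD (lab : Fin n → Lbl m) (e : Sym2 (Fin n)) : Prop :=
  ∃ c d, e = s(c, d) ∧ lab c = Lbl.C ∧ lab d = Lbl.D

/-- `IsCD` is decidable (classically). [folklore] -/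
instance (lab : Fin n → Lbl m) : DecidablePred (IsCD lab) := Classical.decPred _

/-- `{u, v}` is a `C`–`D` edge iff its labels are `C, D` in some order. [folklore] -/
theorem isCD_mk {lab : Fin n → Lbl m} {u v : Fin n} :
    IsCD lab s(u, v) ↔ (lab u = Lbl.C ∧ lab v = Lbl.D) ∨ (lab u = Lbl.D ∧ lab v = Lbl.C) := by
  constructor
  · rintro ⟨c, d, h, hc, hd⟩
    rcases Sym2.eq_iff.1 h with ⟨rfl, rfl⟩ | ⟨rfl, rfl⟩
    · exact Or.inl ⟨hc, hd⟩
    · exact Or.inr ⟨hd, hc⟩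
  · rintro (⟨hu, hv⟩ | ⟨hu, hv⟩)
    · exact ⟨u, v, rfl, hu, hv⟩
    · exact ⟨v, u, Sym2.eq_swap, hv, hu⟩

/-- A `C`–`D` edge respects the partition. [folklore] -/
theorem IsCD.eResp {lab : Fin n → Lbl m} {e : Sym2 (Fin n)} (h : IsCD lab e) : EResp lab e := by
  obtain ⟨c, d, rfl, hc, hd⟩ := h
  simp [hc, hd]

/-- The `r`-matchings between `C` and `D`: `r` pairwise disjoint `C`–`D` edges.
[cite: Rothvoss2017, §3.2 (PDF p. 9: "H is an ℓ-matching if H is a matching with exactly ℓ edges")] -/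
def cdMatchings (lab : Fin n → Lbl m) (r : ℕ) : Finset (Finset (Sym2 (Fin n))) :=
  ((univ.filter (IsCD lab)).powersetCard r).filter fun H =>
    ∀ e ∈ H, ∀ e' ∈ H, ∀ v, v ∈ e → v ∈ e' → e = e'

/-- Membership in `cdMatchings`. [folklore] -/
theorem mem_cdMatchings_iff {lab : Fin n → Lbl m} {r : ℕ} {H : Finset (Sym2 (Fin n))} :
    H ∈ cdMatchings lab r ↔ (∀ e ∈ H, IsCD lab e) ∧ H.card = r ∧
      ∀ e ∈ H, ∀ e' ∈ H, ∀ v, v ∈ e → v ∈ e' → e = e' := by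
  simp only [cdMatchings, mem_filter, mem_powersetCard, subset_iff, mem_univ, true_and]
  tauto

/-- The vertices of `C` covered by `H` (`V(H) ∩ C`). [cite: Rothvoss2017, §3.2 (PDF p. 9)] -/
def cov (lab : Fin n → Lbl m) (H : Finset (Sym2 (Fin n))) : Finset (Fin n) :=
  (lblk lab Lbl.C).filter fun c => ∃ e ∈ H, c ∈ e

/-- Membership in `cov`. [folklore] -/
theorem mem_cov_iff {lab : Fin n → Lbl m} {H : Finset (Sym2 (Fin n))} {c : Fin n} :
    c ∈ cov lab H ↔ lab c = Lbl.C ∧ ∃ e ∈ H, c ∈ e := by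
  simp [cov]

/-! ### The extension sets and the law of the sampler -/

/-- `M^ex_all(T, H) = {M ∈ M_all(T) : M ∩ (C × D) = H}`.
[cite: Rothvoss2017, §3.2 (PDF p. 9: "randomly extend H (so that δ(C) ∩ M = H)")] -/
def Mext (lab : Fin n → Lbl m) (H : Finset (Sym2 (Fin n))) : Finset (Finset (Sym2 (Fin n))) :=
  (Mall lab).filter fun M => M.filter (IsCD lab) = H

/-- `U^ex_all(T, H) = {U ∈ U_all(T) : U ∩ C = V(H) ∩ C}`.
[cite: Rothvoss2017, §3.2 (PDF p. 9: "p^ex_{U,T}(c) := Pr[U ∈ 𝓤 | U ∩ C = c]")] -/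
def Uext (lab : Fin n → Lbl m) (t : ℕ) (H : Finset (Sym2 (Fin n))) : Finset (Finset (Fin n)) :=
  (Uall lab t).filter fun U => U ∩ lblk lab Lbl.C = cov lab H

/-- Membership in `Mext`. [folklore] -/
theorem mem_Mext_iff {lab : Fin n → Lbl m} {H M : Finset (Sym2 (Fin n))} :
    M ∈ Mext lab H ↔ M ∈ Mall lab ∧ M.filter (IsCD lab) = H := by
  simp [Mext]

/-- Membership in `Uext`. [folklore] -/
theorem mem_Uext_iff {lab : Fin n → Lbl m} {t : ℕ} {H : Finset (Sym2 (Fin n))} {U : Finset (Fin n)} :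
    U ∈ Uext lab t H ↔ U ∈ Uall lab t ∧ U ∩ lblk lab Lbl.C = cov lab H := by
  simp [Uext]

/-! ### The crossing edges of an extended pair are exactly `H` -/

section Crossing

variable {lab : Fin n → Lbl m} {t r : ℕ} {H : Finset (Sym2 (Fin n))} {U : Finset (Fin n)}
  {M : Finset (Sym2 (Fin n))}

/-- A respecting edge with one end in `U ∈ U_all(T)` and the other outside `U` has its `U`-end
labelled `C` and its other end labelled `C` or `D`. [folklore] -/
theorem label_of_crossing (hU : U ∈ Uall lab t) {u v : Fin n} (hresp : EResp lab s(u, v))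
    (hu : u ∈ U) (hv : v ∉ U) : lab u = Lbl.C ∧ (lab v = Lbl.C ∨ lab v = Lbl.D) := by
  rw [mem_Uall_iff] at hU
  obtain ⟨-, hAC, hwhole⟩ := hU
  rw [eResp_mk] at hresp
  have huAC := hAC u hu
  -- `lab u` is an `A`-label or `C`
  cases hlu : lab u with
  | A i =>
    -- then `lab v = A i` and `v ∈ U` by wholeness
    exfalso
    rw [hlu] at hresp
    have hlv : lab v = Lbl.A i := cls_eq_A_iff.1 hresp.symm
    exact hv (hwhole u hu v (by rw [hlv, hlu]) (by rw [hlu]; rfl))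
  | C =>
    refine ⟨rfl, ?_⟩
    rw [hlu, cls_C] at hresp
    exact cls_eq_C_iff.1 hresp.symm
  | D => rw [hlu] at huAC; exact absurd huAC (by simp [Lbl.isAC])
  | B i => rw [hlu] at huAC; exact absurd huAC (by simp [Lbl.isAC])

/-- **For `U ∈ U^ex_all(T,H)` and `M ∈ M^ex_all(T,H)` the crossing edges `δ(U) ∩ M` are exactly
`H`** (so `|δ(U) ∩ M| = |H|`: the `3`-sampler is supported on `Q_3`, the `k`-sampler on `Q_k`).
[cite: Rothvoss2017, §3.1 (PDF p. 8: "the intersection δ(U) ∩ M can only contain edges in E(C ∪ D)")] -/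
theorem filter_crosses_eq_of_mem_ext (hH : H ∈ cdMatchings lab r) (hU : U ∈ Uext lab t H)
    (hM : M ∈ Mext lab H) : M.filter (Crosses U) = H := by
  rw [mem_Uext_iff] at hU
  rw [mem_Mext_iff, mem_Mall_iff] at hM
  obtain ⟨hUall, hUC⟩ := hU
  obtain ⟨⟨hPM, hresp⟩, hMH⟩ := hM
  obtain ⟨hHcd, -, -⟩ := mem_cdMatchings_iff.1 hH
  ext e
  rw [mem_filter]
  constructor
  · rintro ⟨heM, hcross⟩
    induction e using Sym2.ind with
    | h u v =>
      rw [crosses_mk] at hcross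
      -- orient the edge: `u ∈ U`, `v ∉ U`
      wlog huv : u ∈ U ∧ v ∉ U generalizing u v
      · have h' : v ∈ U ∧ u ∉ U := by tauto
        have := this v u (by rwa [Sym2.eq_swap]) (Or.inl h') h'
        rwa [Sym2.eq_swap]
      obtain ⟨hu, hv⟩ := huv
      obtain ⟨hlu, hlv⟩ := label_of_crossing hUall (hresp _ heM) hu hv
      -- `u ∈ U ∩ C = cov H`: `u` lies on an edge `h ∈ H ⊆ M`, hence `h = {u, v}`
      have hucov : u ∈ cov lab H := by
        rw [← hUC, mem_inter, mem_lblk]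
        exact ⟨hu, hlu⟩
      obtain ⟨-, h, hhH, huh⟩ := mem_cov_iff.1 hucov
      have hhM : h ∈ M := by
        have : h ∈ M.filter (IsCD lab) := by rw [hMH]; exact hhH
        exact (mem_filter.1 this).1
      have := hPM.unique heM hhM (Sym2.mem_mk_left u v) huh
      rw [this]
      exact hhH
  · intro heH
    have heM : e ∈ M.filter (IsCD lab) := by rw [hMH]; exact heH
    rw [mem_filter] at heM
    refine ⟨heM.1, ?_⟩
    obtain ⟨c, d, rfl, hc, hd⟩ := hHcd e heH
    rw [crosses_mk]
    refine Or.inl ⟨?_, ?_⟩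
    · -- `c ∈ cov H = U ∩ C`
      have : c ∈ cov lab H := mem_cov_iff.2 ⟨hc, _, heH, Sym2.mem_mk_left _ _⟩
      rw [← hUC, mem_inter] at this
      exact this.1
    · -- `d` is labelled `D`, not in `A ∪ C ⊇ U`
      intro hdU
      have := (mem_Uall_iff.1 hUall).2.1 d hdU
      rw [hd] at this
      exact absurd this (by simp [Lbl.isAC])

/-- Consequently the crossing number of an extended pair is `r`. [folklore] -/
theorem card_filter_crosses_of_mem_ext (hH : H ∈ cdMatchings lab r) (hU : U ∈ Uext lab t H)
    (hM : M ∈ Mext lab H) : (M.filter (Crosses U)).card = r := by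
  rw [filter_crosses_eq_of_mem_ext hH hU hM]
  exact (mem_cdMatchings_iff.1 hH).2.1

end Crossing

/-! ### The law of the sampler: uniform on the compatible triples `(T, U, M)` -/

variable (n m k) in
/-- **The sample space `Ω_r`**: triples `(T, U, M)` such that `H := M ∩ (C × D)` is an `r`-matching
between `C` and `D`, `U ∈ U^ex_all(T, H)` and `M ∈ M^ex_all(T, H)` — the outcomes of Rothvoß's
generating procedure "pick a partition `T`, an `r`-matching `H` between `C` and `D`, and extend"
(`H` is determined by `(T, M)`). [cite: Rothvoss2017, §3.2 (PDF p. 9)] -/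
def Omega (t r : ℕ) : Finset ((Fin n → Lbl m) × Finset (Fin n) × Finset (Sym2 (Fin n))) :=
  ((partitions n m k) ×ˢ ((univ : Finset (Finset (Fin n))) ×ˢ (univ : Finset (Finset (Sym2 (Fin n)))))).filter
    fun ω => ω.2.2.filter (IsCD ω.1) ∈ cdMatchings ω.1 r ∧
      ω.2.1 ∈ Uext ω.1 t (ω.2.2.filter (IsCD ω.1)) ∧ ω.2.2 ∈ Mext ω.1 (ω.2.2.filter (IsCD ω.1))

/-- Membership in `Omega`. [folklore] -/
theorem mem_Omega_iff {t r : ℕ} {ω : (Fin n → Lbl m) × Finset (Fin n) × Finset (Sym2 (Fin n))} :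
    ω ∈ Omega n m k t r ↔ ω.1 ∈ partitions n m k ∧ ω.2.2.filter (IsCD ω.1) ∈ cdMatchings ω.1 r ∧
      ω.2.1 ∈ Uext ω.1 t (ω.2.2.filter (IsCD ω.1)) ∧ ω.2.2 ∈ Mext ω.1 (ω.2.2.filter (IsCD ω.1)) := by
  simp [Omega]

/-- A compatible triple from its pieces. [folklore] -/
theorem mk_mem_Omega {t r : ℕ} {lab : Fin n → Lbl m} {H : Finset (Sym2 (Fin n))} {U : Finset (Fin n)}
    {M : Finset (Sym2 (Fin n))} (hlab : lab ∈ partitions n m k) (hH : H ∈ cdMatchings lab r)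
    (hU : U ∈ Uext lab t H) (hM : M ∈ Mext lab H) : (lab, U, M) ∈ Omega n m k t r := by
  have hMH : M.filter (IsCD lab) = H := (mem_Mext_iff.1 hM).2
  rw [mem_Omega_iff]
  simp only [hMH]
  exact ⟨hlab, hH, hU, hM⟩

variable (n m k) in
/-- The outcomes of `Ω_r` inside the rectangle `X × Y`. [cite: Rothvoss2017, §3.2 (PDF p. 9)] -/
def OmegaR (t r : ℕ) (X : Finset (Finset (Fin n))) (Y : Finset (Finset (Sym2 (Fin n)))) :
    Finset ((Fin n → Lbl m) × Finset (Fin n) × Finset (Sym2 (Fin n))) :=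
  (Omega n m k t r).filter fun ω => ω.2.1 ∈ X ∧ ω.2.2 ∈ Y

variable (n m k) in
/-- **The law of the sampler**: the probability that the procedure "uniform `(T, U, M) ∈ Ω_r`"
outputs the pair `(U, M)`. For `r = 3` these pairs are Rothvoß's `μ_3`-samples, for `r = k`
his `μ_k`-samples; we use the law itself as the weight (see the file header).
[cite: Rothvoss2017, §3.2 (PDF p. 9)] -/
def law (t r : ℕ) (U : Finset (Fin n)) (M : Finset (Sym2 (Fin n))) : ℝ :=
  (((Omega n m k t r).filter fun ω => ω.2.1 = U ∧ ω.2.2 = M).card : ℝ) / (Omega n m k t r).card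

/-- The law is nonnegative. [folklore] -/
theorem law_nonneg (t r : ℕ) (U : Finset (Fin n)) (M : Finset (Sym2 (Fin n))) :
    0 ≤ law n m k t r U M :=
  div_nonneg (Nat.cast_nonneg _) (Nat.cast_nonneg _)

/-- **Support of the law**: if `law n m k t r U M ≠ 0` then `|δ(U) ∩ M| = r`.
[cite: Rothvoss2017, §3.2 (PDF p. 9)] -/
theorem card_filter_crosses_of_law_ne_zero {t r : ℕ} {U : Finset (Fin n)}
    {M : Finset (Sym2 (Fin n))} (h : law n m k t r U M ≠ 0) : (M.filter (Crosses U)).card = r := by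
  classical
  have hne : ((Omega n m k t r).filter fun ω => ω.2.1 = U ∧ ω.2.2 = M).Nonempty := by
    rw [← card_pos]
    by_contra h0
    push Not at h0
    have : ((Omega n m k t r).filter fun ω => ω.2.1 = U ∧ ω.2.2 = M).card = 0 := by omega
    exact h (by rw [law, this, Nat.cast_zero, zero_div])
  obtain ⟨ω, hω⟩ := hne
  rw [mem_filter] at hω
  obtain ⟨hω, rfl, rfl⟩ := hω
  obtain ⟨-, hH, hU, hM⟩ := mem_Omega_iff.1 hω
  exact card_filter_crosses_of_mem_ext hH hU hM

/-- **The law of a rectangle is the proportion of `Ω_r` inside it**: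
`Σ_{U ∈ X} Σ_{M ∈ Y} law(U, M) = |Ω_r ∩ (X × Y)| / |Ω_r|`. [cite: Rothvoss2017, §3.2 (PDF p. 9)] -/
theorem sum_sum_law_eq (t r : ℕ) (X : Finset (Finset (Fin n))) (Y : Finset (Finset (Sym2 (Fin n)))) :
    ∑ U ∈ X, ∑ M ∈ Y, law n m k t r U M =
      ((OmegaR n m k t r X Y).card : ℝ) / (Omega n m k t r).card := by
  classical
  unfold law
  simp only [← sum_div]
  congr 1
  rw [OmegaR, card_eq_sum_card_fiberwise (f := fun ω => (ω.2.1, ω.2.2)) (t := X ×ˢ Y)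
    (s := (Omega n m k t r).filter fun ω => ω.2.1 ∈ X ∧ ω.2.2 ∈ Y)
    (fun ω hω => mem_product.2 (mem_filter.1 hω).2)]
  push_cast
  rw [sum_product]
  refine sum_congr rfl fun U hU => sum_congr rfl fun M hM => ?_
  congr 2
  ext ω
  simp only [mem_filter, Prod.mk.injEq]
  constructor
  · rintro ⟨hω, h1, h2⟩
    exact ⟨⟨hω, h1 ▸ hU, h2 ▸ hM⟩, h1, h2⟩
  · rintro ⟨⟨hω, -, -⟩, h1, h2⟩
    exact ⟨hω, h1, h2⟩

/-! ### Non-emptiness of the sampling sets -/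

section Nonempty

/-- **A labelling with prescribed fibre sizes exists** whenever the sizes add up to the number
of points (transport the first projection of `Σ ℓ, Fin (s ℓ)` along a bijection). [folklore] -/
theorem exists_fun_card_fiber_eq {α ι : Type*} [Fintype α] [Fintype ι] [DecidableEq ι] (s : ι → ℕ)
    (h : ∑ i, s i = Fintype.card α) : ∃ f : α → ι, ∀ i, (univ.filter fun a => f a = i).card = s i := by
  classical
  have hcard : Fintype.card α = Fintype.card (Σ i, Fin (s i)) := by
    rw [Fintype.card_sigma]; simp [h.symm]
  let e : α ≃ Σ i, Fin (s i) := Fintype.equivOfCardEq hcard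
  refine ⟨fun a => (e a).1, fun i => ?_⟩
  -- the fibre of `i` is the image of `Fin (s i)` under `y ↦ e⁻¹ ⟨i, y⟩`
  let emb : Fin (s i) ↪ α := ⟨fun y => e.symm ⟨i, y⟩, fun y y' hy => by
    have := e.symm.injective hy
    simp only [Sigma.mk.inj_iff, heq_eq_eq, true_and] at this
    exact this⟩
  have hset : (univ.filter fun a => (e a).1 = i) = (univ : Finset (Fin (s i))).map emb := by
    ext a
    simp only [mem_filter, mem_univ, true_and, mem_map, emb, Function.Embedding.coeFn_mk]
    constructor
    · intro ha
      obtain ⟨x, hx⟩ : ∃ x, e a = x := ⟨_, rfl⟩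
      obtain ⟨i', y⟩ := x
      rw [hx] at ha
      change i' = i at ha
      subst ha
      exact ⟨y, by rw [← hx, Equiv.symm_apply_apply]⟩
    · rintro ⟨y, rfl⟩
      simp
  change (univ.filter fun a => (e a).1 = i).card = s i
  rw [hset, card_map, card_univ, Fintype.card_fin]

/-- The block sizes add up: `m(k-3) + k + k + 2m(k-3) = 3m(k-3) + 2k`. [cite: Rothvoss2017, §2 (PDF p. 6: "|V| = n = 3m(k-3) + 2k")] -/
theorem sum_size (m k : ℕ) : ∑ ℓ : Lbl m, ℓ.size k = 3 * m * (k - 3) + 2 * k := by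
  rw [← Lbl.equivSum.symm.sum_comp]
  simp only [Fintype.sum_sum_type, Fintype.sum_unique]
  simp only [Lbl.equivSum, Equiv.coe_fn_symm_mk, Lbl.size, sum_const, card_univ, Fintype.card_fin,
    smul_eq_mul]
  ring

/-- **Partitions exist** (`n = 3m(k-3) + 2k`). [cite: Rothvoss2017, §3.1 (PDF p. 8)] -/
theorem partitions_nonempty (m k : ℕ) : (partitions (3 * m * (k - 3) + 2 * k) m k).Nonempty := by
  classical
  obtain ⟨f, hf⟩ := exists_fun_card_fiber_eq (α := Fin (3 * m * (k - 3) + 2 * k)) (ι := Lbl m)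
    (fun ℓ => ℓ.size k) (by rw [sum_size, Fintype.card_fin])
  exact ⟨f, mem_partitions_iff.2 fun ℓ => hf ℓ⟩

variable {lab : Fin n → Lbl m} {r t : ℕ} {H : Finset (Sym2 (Fin n))}

/-- A `C`–`D` edge meets the block with label `C` (resp. `D`) in exactly one vertex. [folklore] -/
theorem card_filter_lblk_mem {e : Sym2 (Fin n)} (he : IsCD lab e) {ℓ : Lbl m} (hℓ : ℓ = Lbl.C ∨ ℓ = Lbl.D) :
    ((lblk lab ℓ).filter fun c => c ∈ e).card = 1 := by
  obtain ⟨c, d, rfl, hc, hd⟩ := he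
  rw [card_eq_one]
  rcases hℓ with rfl | rfl
  · refine ⟨c, ?_⟩
    ext x
    simp only [mem_filter, mem_lblk, Sym2.mem_iff, mem_singleton]
    constructor
    · rintro ⟨hx, rfl | rfl⟩
      · rfl
      · rw [hd] at hx; cases hx
    · rintro rfl; exact ⟨hc, Or.inl rfl⟩
  · refine ⟨d, ?_⟩
    ext x
    simp only [mem_filter, mem_lblk, Sym2.mem_iff, mem_singleton]
    constructor
    · rintro ⟨hx, rfl | rfl⟩
      · rw [hc] at hx; cases hx
      · rfl
    · rintro rfl; exact ⟨hd, Or.inr rfl⟩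

/-- The vertices of the block `ℓ ∈ {C, D}` covered by the `r`-matching `H` number `r`. [folklore] -/
theorem card_filter_lblk_covered (hH : H ∈ cdMatchings lab r) {ℓ : Lbl m} (hℓ : ℓ = Lbl.C ∨ ℓ = Lbl.D) :
    ((lblk lab ℓ).filter fun c => ∃ e ∈ H, c ∈ e).card = r := by
  classical
  obtain ⟨hcd, hcard, hdisj⟩ := mem_cdMatchings_iff.1 hH
  have hbi : ((lblk lab ℓ).filter fun c => ∃ e ∈ H, c ∈ e) =
      H.biUnion fun e => (lblk lab ℓ).filter fun c => c ∈ e := by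
    ext c
    simp only [mem_filter, mem_biUnion, mem_lblk]
    constructor
    · rintro ⟨hc, e, he, hce⟩; exact ⟨e, he, hc, hce⟩
    · rintro ⟨e, he, hc, hce⟩; exact ⟨hc, e, he, hce⟩
  rw [hbi, card_biUnion]
  · rw [sum_congr rfl fun e he => card_filter_lblk_mem (hcd e he) hℓ, sum_const, smul_eq_mul, mul_one,
      hcard]
  · intro e he e' he' hne
    rw [Function.onFun, disjoint_left]
    intro c hc hc'
    exact hne (hdisj e he e' he' c (mem_filter.1 hc).2 (mem_filter.1 hc').2)

/-- **`|V(H) ∩ C| = r`** for an `r`-matching `H` between `C` and `D`. [folklore] -/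
theorem card_cov (hH : H ∈ cdMatchings lab r) : (cov lab H).card = r :=
  card_filter_lblk_covered hH (Or.inl rfl)

/-- **`r`-matchings between `C` and `D` exist** for `r ≤ k` (pair off `r` vertices of `C` with
`r` vertices of `D` along enumerations of the two blocks). [folklore] -/
theorem cdMatchings_nonempty (hlab : lab ∈ partitions n m k) (hr : r ≤ k) :
    (cdMatchings lab r).Nonempty := by
  classical
  have hC : (lblk lab Lbl.C).card = k := (mem_partitions_iff.1 hlab) Lbl.C
  have hD : (lblk lab Lbl.D).card = k := (mem_partitions_iff.1 hlab) Lbl.D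
  let eC : lblk lab Lbl.C ≃ Fin k := Finset.equivFinOfCardEq hC
  let eD : lblk lab Lbl.D ≃ Fin k := Finset.equivFinOfCardEq hD
  let c : Fin r → Fin n := fun j => (eC.symm (Fin.castLE hr j)).1
  let d : Fin r → Fin n := fun j => (eD.symm (Fin.castLE hr j)).1
  have hc : ∀ j, lab (c j) = Lbl.C := fun j => mem_lblk.1 (eC.symm (Fin.castLE hr j)).2
  have hd : ∀ j, lab (d j) = Lbl.D := fun j => mem_lblk.1 (eD.symm (Fin.castLE hr j)).2
  have hcinj : Function.Injective c := fun j j' h =>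
    Fin.castLE_injective hr (eC.symm.injective (Subtype.ext h))
  have hdinj : Function.Injective d := fun j j' h =>
    Fin.castLE_injective hr (eD.symm.injective (Subtype.ext h))
  have hcd : ∀ j j', c j ≠ d j' := fun j j' h => by
    have := hc j; rw [h, hd j'] at this; cases this
  let edge : Fin r → Sym2 (Fin n) := fun j => s(c j, d j)
  have hedge : Function.Injective edge := by
    intro j j' h
    rcases Sym2.eq_iff.1 h with ⟨h1, -⟩ | ⟨h1, -⟩
    · exact hcinj h1
    · exact absurd h1 (hcd j j')
  refine ⟨univ.image edge, mem_cdMatchings_iff.2 ⟨?_, ?_, ?_⟩⟩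
  · intro e he
    obtain ⟨j, -, rfl⟩ := mem_image.1 he
    exact ⟨c j, d j, rfl, hc j, hd j⟩
  · rw [card_image_of_injective _ hedge, card_univ, Fintype.card_fin]
  · intro e he e' he' v hv hv'
    obtain ⟨j, -, rfl⟩ := mem_image.1 he
    obtain ⟨j', -, rfl⟩ := mem_image.1 he'
    change v ∈ s(c j, d j) at hv
    change v ∈ s(c j', d j') at hv'
    rw [Sym2.mem_iff] at hv hv'
    rcases hv with rfl | rfl <;> rcases hv' with h | h
    · rw [hcinj h]
    · exact absurd h (hcd j j')
    · exact absurd h.symm (hcd j' j)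
    · rw [hdinj h]

/-- **Extensions of `H` to cuts exist**: for an `r`-matching `H` and `j ≤ m` with
`r + j(k-3) = t`, the set `V(H) ∩ C` together with the blocks `A_0, …, A_{j-1}` lies in
`U^ex_all(T, H)`. [cite: Rothvoss2017, §3.1 (PDF p. 8)] -/
theorem uext_nonempty (hlab : lab ∈ partitions n m k) (hH : H ∈ cdMatchings lab r) {j : ℕ}
    (hj : j ≤ m) (ht : r + j * (k - 3) = t) : (Uext lab t H).Nonempty := by
  classical
  -- the `A`-part
  let Apart : Finset (Fin n) := univ.filter fun v => ∃ i : Fin m, lab v = Lbl.A i ∧ (i : ℕ) < j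
  have hAcard : Apart.card = j * (k - 3) := by
    have hbi : Apart = (univ.filter fun i : Fin m => (i : ℕ) < j).biUnion fun i => lblk lab (Lbl.A i) := by
      ext v
      simp only [Apart, mem_filter, mem_univ, true_and, mem_biUnion, mem_lblk]
      constructor
      · rintro ⟨i, hi, hij⟩; exact ⟨i, hij, hi⟩
      · rintro ⟨i, hij, hi⟩; exact ⟨i, hi, hij⟩
    rw [hbi, card_biUnion]
    · have hsz : ∀ i ∈ (univ.filter fun i : Fin m => (i : ℕ) < j), (lblk lab (Lbl.A i)).card = k - 3 :=
        fun i _ => (mem_partitions_iff.1 hlab) (Lbl.A i)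
      rw [sum_congr rfl hsz, sum_const, smul_eq_mul, Fin.card_filter_val_lt, min_eq_right hj]
    · intro i _ i' _ hne
      rw [Function.onFun, disjoint_left]
      intro v hv hv'
      rw [mem_lblk] at hv hv'
      have := hv.symm.trans hv'
      simp only [Lbl.A.injEq] at this
      exact hne this
  have hAlab : ∀ v ∈ Apart, ∃ i : Fin m, lab v = Lbl.A i ∧ (i : ℕ) < j := fun v hv =>
    (mem_filter.1 hv).2
  have hcovlab : ∀ v ∈ cov lab H, lab v = Lbl.C := fun v hv => (mem_cov_iff.1 hv).1
  have hdisj : Disjoint (cov lab H) Apart := by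
    rw [disjoint_left]
    intro v hv hv'
    obtain ⟨i, hi, -⟩ := hAlab v hv'
    have := (hcovlab v hv).symm.trans hi
    cases this
  refine ⟨cov lab H ∪ Apart, mem_Uext_iff.2 ⟨mem_Uall_iff.2 ⟨?_, ?_, ?_⟩, ?_⟩⟩
  · rw [card_union_of_disjoint hdisj, card_cov hH, hAcard, ht]
  · intro v hv
    rcases mem_union.1 hv with hv | hv
    · rw [hcovlab v hv]; rfl
    · obtain ⟨i, hi, -⟩ := hAlab v hv
      rw [hi]; rfl
  · intro u hu v hvu hA
    rcases mem_union.1 hu with hu | hu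
    · rw [hcovlab u hu] at hA
      exact absurd hA (by simp [Lbl.isA])
    · obtain ⟨i, hi, hij⟩ := hAlab u hu
      exact mem_union_right _ (mem_filter.2 ⟨mem_univ _, i, by rw [hvu, hi], hij⟩)
  · ext v
    simp only [mem_inter, mem_union, mem_lblk]
    constructor
    · rintro ⟨hv | hv, hC⟩
      · exact hv
      · obtain ⟨i, hi, -⟩ := hAlab v hv
        rw [hi] at hC; cases hC
    · intro hv
      exact ⟨Or.inl hv, hcovlab v hv⟩

/-! #### Perfect matchings extending `H` -/

/-- The vertices covered by `H`. [folklore] -/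
def verts (H : Finset (Sym2 (Fin n))) : Finset (Fin n) := univ.filter fun v => ∃ e ∈ H, v ∈ e

/-- Membership in `verts`. [folklore] -/
@[simp] theorem mem_verts {v : Fin n} : v ∈ verts H ↔ ∃ e ∈ H, v ∈ e := by simp [verts]

/-- An `r`-matching between `C` and `D` is a perfect matching of its vertex set. [folklore] -/
theorem isPMOn_verts (hH : H ∈ cdMatchings lab r) : IsPMOn (verts H) H := by
  classical
  obtain ⟨hcd, -, hdisj⟩ := mem_cdMatchings_iff.1 hH
  refine ⟨fun e he => ?_, fun e he => ?_, fun v hv => ?_⟩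
  · rw [mem_sym2_iff]
    intro v hv
    exact mem_verts.2 ⟨e, he, hv⟩
  · obtain ⟨c, d, rfl, hc, hd⟩ := hcd e he
    rw [Sym2.mk_isDiag_iff]
    intro h
    rw [h, hd] at hc
    cases hc
  · obtain ⟨e, he, hve⟩ := mem_verts.1 hv
    rw [card_eq_one]
    refine ⟨e, ?_⟩
    ext e'
    simp only [mem_filter, mem_singleton]
    exact ⟨fun h => hdisj e' h.1 e he v h.2 hve, fun h => h ▸ ⟨he, hve⟩⟩

/-- Vertices covered by `H` are labelled `C` or `D`. [folklore] -/
theorem label_of_mem_verts (hH : H ∈ cdMatchings lab r) {v : Fin n} (hv : v ∈ verts H) :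
    lab v = Lbl.C ∨ lab v = Lbl.D := by
  obtain ⟨e, he, hve⟩ := mem_verts.1 hv
  obtain ⟨c, d, rfl, hc, hd⟩ := (mem_cdMatchings_iff.1 hH).1 e he
  rcases Sym2.mem_iff.1 hve with rfl | rfl
  · exact Or.inl hc
  · exact Or.inr hd

/-- **Extensions of `H` to perfect matchings exist**: an `r`-matching `H` between `C` and `D`
with `k - r` even extends, by perfect matchings inside each block `A_i`, `B_i` (sizes `k-3`,
`2(k-3)`, even for odd `k`) and inside `C ∖ V(H)`, `D ∖ V(H)`, to a member of `M^ex_all(T, H)`.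
[cite: Rothvoss2017, §3.2 (PDF p. 9: "randomly extend H")] -/
theorem mext_nonempty (hlab : lab ∈ partitions n m k) (hH : H ∈ cdMatchings lab r) (hk : Odd k)
    (hr : r ≤ k) (hkr : Even (k - r)) : (Mext lab H).Nonempty := by
  classical
  -- the uncovered part of each block, all of even size
  let R : Lbl m → Finset (Fin n) := fun ℓ => (lblk lab ℓ).filter fun v => v ∉ verts H
  have hReven : ∀ ℓ, Even (R ℓ).card := by
    intro ℓ
    have hsize := (mem_partitions_iff.1 hlab) ℓ
    have hsplit : (R ℓ).card + ((lblk lab ℓ).filter fun v => v ∈ verts H).card = (lblk lab ℓ).card := by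
      rw [add_comm]; exact card_filter_add_card_filter_not _
    have hk3 : Even (k - 3) := by
      obtain ⟨j, hj⟩ := hk; exact ⟨j - 1, by omega⟩
    by_cases hℓ : ℓ = Lbl.C ∨ ℓ = Lbl.D
    · have hcov : ((lblk lab ℓ).filter fun v => v ∈ verts H).card = r := by
        have : ((lblk lab ℓ).filter fun v => v ∈ verts H) = (lblk lab ℓ).filter fun c => ∃ e ∈ H, c ∈ e :=
          filter_congr fun v _ => by rw [mem_verts]
        rw [this]
        exact card_filter_lblk_covered hH hℓ
      rw [hcov, hsize] at hsplit
      have hk' : ℓ.size k = k := by rcases hℓ with rfl | rfl <;> rfl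
      rw [hk'] at hsplit
      have : (R ℓ).card = k - r := by omega
      rw [this]; exact hkr
    · -- an `A` or `B` block: untouched by `H`
      have h0 : ((lblk lab ℓ).filter fun v => v ∈ verts H) = ∅ := by
        refine filter_false_of_mem fun v hv hv' => hℓ ?_
        rw [mem_lblk] at hv
        rw [← hv]
        exact label_of_mem_verts hH hv'
      rw [h0, card_empty, add_zero, hsize] at hsplit
      rw [hsplit]
      cases ℓ with
      | A i => exact hk3
      | B i => exact ⟨k - 3, two_mul _⟩
      | C => exact absurd (Or.inl rfl) hℓ
      | D => exact absurd (Or.inr rfl) hℓ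
  -- perfect matchings of the uncovered parts
  choose M hM using fun ℓ => exists_isPMOn_of_even (R ℓ).card (R ℓ) rfl (hReven ℓ)
  have hRdisj : ∀ ℓ ℓ' : Lbl m, ℓ ≠ ℓ' → Disjoint (R ℓ) (R ℓ') := by
    intro ℓ ℓ' hne
    rw [disjoint_left]
    intro v hv hv'
    have h1 := mem_lblk.1 (mem_filter.1 hv).1
    have h2 := mem_lblk.1 (mem_filter.1 hv').1
    exact hne (h1.symm.trans h2)
  have hrest : IsPMOn (univ.biUnion R) (univ.biUnion M) :=
    isPMOn_biUnion R hRdisj univ M (fun ℓ _ => hM ℓ)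
  -- together with `H`
  have hdisjH : Disjoint (verts H) (univ.biUnion R) := by
    rw [disjoint_biUnion_right]
    intro ℓ _
    rw [disjoint_left]
    intro v hv hv'
    exact (mem_filter.1 hv').2 hv
  have hall : verts H ∪ univ.biUnion R = univ := by
    ext v
    simp only [mem_union, mem_biUnion, mem_univ, true_and, iff_true]
    by_cases hv : v ∈ verts H
    · exact Or.inl hv
    · exact Or.inr ⟨lab v, mem_filter.2 ⟨mem_lblk.2 rfl, hv⟩⟩
  have hPM : IsPMOn (univ : Finset (Fin n)) (H ∪ univ.biUnion M) := by
    rw [← hall]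
    exact (isPMOn_verts hH).union hrest hdisjH
  -- the edges of `M ℓ` have both ends labelled `ℓ`
  have hMlab : ∀ ℓ, ∀ e ∈ M ℓ, ∀ v ∈ e, lab v = ℓ := fun ℓ e he v hv =>
    mem_lblk.1 (mem_filter.1 (mem_sym2_iff.1 ((hM ℓ).subset_sym2 he) v hv)).1
  refine ⟨H ∪ univ.biUnion M, mem_Mext_iff.2 ⟨mem_Mall_iff.2 ⟨hPM, fun e he => ?_⟩, ?_⟩⟩
  · -- respecting
    rcases mem_union.1 he with he | he
    · exact ((mem_cdMatchings_iff.1 hH).1 e he).eResp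
    · obtain ⟨ℓ, -, he⟩ := mem_biUnion.1 he
      induction e using Sym2.ind with
      | h u v =>
        rw [eResp_mk, hMlab ℓ _ he u (Sym2.mem_mk_left _ _), hMlab ℓ _ he v (Sym2.mem_mk_right _ _)]
  · -- the `C`–`D` edges are exactly `H`
    ext e
    simp only [mem_filter, mem_union, mem_biUnion, mem_univ, true_and]
    constructor
    · rintro ⟨he | ⟨ℓ, he⟩, hcd⟩
      · exact he
      · exfalso
        obtain ⟨c, d, rfl, hc, hd⟩ := hcd
        have h1 := hMlab ℓ _ he c (Sym2.mem_mk_left _ _)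
        have h2 := hMlab ℓ _ he d (Sym2.mem_mk_right _ _)
        rw [hc] at h1; rw [hd] at h2
        rw [← h1] at h2
        cases h2
    · intro he
      exact ⟨Or.inl he, (mem_cdMatchings_iff.1 hH).1 e he⟩

/-! #### Total mass of the law -/

/-- **`Ω_r` is nonempty** once partitions and `r`-matchings exist and extend (the hypotheses are
discharged by `partitions_nonempty`, `cdMatchings_nonempty`, `uext_nonempty`, `mext_nonempty`).
[cite: Rothvoss2017, §3.2 (PDF p. 9)] -/
theorem omega_nonempty (hP : (partitions n m k).Nonempty)
    (hH : ∀ lab ∈ partitions n m k, (cdMatchings lab r).Nonempty)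
    (hU : ∀ lab ∈ partitions n m k, ∀ H ∈ cdMatchings lab r, (Uext lab t H).Nonempty)
    (hM : ∀ lab ∈ partitions n m k, ∀ H ∈ cdMatchings lab r, (Mext lab H).Nonempty) :
    (Omega n m k t r).Nonempty := by
  obtain ⟨lab, hlab⟩ := hP
  obtain ⟨H, hHm⟩ := hH lab hlab
  obtain ⟨U, hUm⟩ := hU lab hlab H hHm
  obtain ⟨M, hMm⟩ := hM lab hlab H hHm
  exact ⟨_, mk_mem_Omega hlab hHm hUm hMm⟩

/-- Every outcome has an odd cut (of size `t`) and a perfect matching. [folklore] -/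
theorem omegaR_univ_eq (ht : Odd t) :
    OmegaR n m k t r (univ.filter fun U : Finset (Fin n) => Odd U.card)
      (perfectMatchings (univ : Finset (Fin n))) = Omega n m k t r := by
  rw [OmegaR]
  refine filter_true_of_mem fun ω hω => ?_
  obtain ⟨-, -, hU, hM⟩ := mem_Omega_iff.1 hω
  refine ⟨mem_filter.2 ⟨mem_univ _, ?_⟩, (mem_filter.1 (mem_Mext_iff.1 hM).1).1⟩
  rw [(mem_Uall_iff.1 (mem_Uext_iff.1 hU).1).1]
  exact ht

/-- **The law is a probability distribution**: summed over all odd cuts and all perfect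
matchings it gives `1` (for odd `t` and nonempty `Ω_r`). [cite: Rothvoss2017, §3.2 (PDF p. 9)] -/
theorem sum_sum_law_univ (ht : Odd t) (hne : (Omega n m k t r).Nonempty) :
    ∑ U ∈ (univ.filter fun U : Finset (Fin n) => Odd U.card),
      ∑ M ∈ perfectMatchings (univ : Finset (Fin n)), law n m k t r U M = 1 := by
  rw [sum_sum_law_eq, omegaR_univ_eq ht, div_self]
  exact_mod_cast (card_pos.2 hne).ne'

end Nonempty

/-! ### The conditional probabilities `p_U`, `p_M` of a rectangle -/

/-- `p_U(X; T, H) = |X ∩ U^ex_all(T,H)| / |U^ex_all(T,H)|`, Rothvoß's `p^ex_{U,T}(H)` for the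
rows `X` of a rectangle. [cite: Rothvoss2017, §3.2 (PDF p. 9)] -/
def pU (X : Finset (Finset (Fin n))) (lab : Fin n → Lbl m) (t : ℕ) (H : Finset (Sym2 (Fin n))) : ℝ :=
  ((X ∩ Uext lab t H).card : ℝ) / (Uext lab t H).card

/-- `p_M(Y; T, H) = |Y ∩ M^ex_all(T,H)| / |M^ex_all(T,H)|`, Rothvoß's `p^ex_{M,T}(H)` for the
columns `Y` of a rectangle. [cite: Rothvoss2017, §3.2 (PDF p. 9)] -/
def pM (Y : Finset (Finset (Sym2 (Fin n)))) (lab : Fin n → Lbl m) (H : Finset (Sym2 (Fin n))) : ℝ :=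
  ((Y ∩ Mext lab H).card : ℝ) / (Mext lab H).card

/-- `0 ≤ p_U`. [folklore] -/
theorem pU_nonneg (X : Finset (Finset (Fin n))) (lab : Fin n → Lbl m) (t : ℕ) (H : Finset (Sym2 (Fin n))) :
    0 ≤ pU X lab t H := div_nonneg (Nat.cast_nonneg _) (Nat.cast_nonneg _)

/-- `0 ≤ p_M`. [folklore] -/
theorem pM_nonneg (Y : Finset (Finset (Sym2 (Fin n)))) (lab : Fin n → Lbl m) (H : Finset (Sym2 (Fin n))) :
    0 ≤ pM Y lab H := div_nonneg (Nat.cast_nonneg _) (Nat.cast_nonneg _)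

/-- `p_U ≤ 1`. [folklore] -/
theorem pU_le_one (X : Finset (Finset (Fin n))) (lab : Fin n → Lbl m) (t : ℕ) (H : Finset (Sym2 (Fin n))) :
    pU X lab t H ≤ 1 := by
  rw [pU]
  rcases Nat.eq_zero_or_pos (Uext lab t H).card with h | h
  · rw [h]; simp
  · rw [div_le_one (by exact_mod_cast h)]
    exact_mod_cast card_le_card inter_subset_right

/-- `p_M ≤ 1`. [folklore] -/
theorem pM_le_one (Y : Finset (Finset (Sym2 (Fin n)))) (lab : Fin n → Lbl m) (H : Finset (Sym2 (Fin n))) :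
    pM Y lab H ≤ 1 := by
  rw [pM]
  rcases Nat.eq_zero_or_pos (Mext lab H).card with h | h
  · rw [h]; simp
  · rw [div_le_one (by exact_mod_cast h)]
    exact_mod_cast card_le_card inter_subset_right

end Literature.Barriers.PneNP
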